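import Literature.AlgebraicGeometry.HodgeTheory.RibetTypeSeventeenPartnerPowersHodgeClasses
import Literature.AlgebraicGeometry.Motives.HodgeThetaSubalgebraUnitaryEightFifteenCore
import Literature.AlgebraicGeometry.Motives.HodgeThetaSubalgebraUnitaryNineFourteenCore
import Literature.AlgebraicGeometry.Motives.HodgeThetaSubalgebraUnitaryTenTwentyOneCore
import HarnessLib

/-!
# Hodge classes on all powers of abelian varieties of Ribet type `(10, 21)`, `(9, 22)`, `(8, 23)` are generated by
# divisor classes (Ribet 1983 Thm. 3 at these multiplicities — UNCONDITIONAL; 31-FOLDS `{10, 21}`, `{9, 22}`, `{8, 23}`)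

Family `hodge`, layer `Literature/AlgebraicGeometry/HodgeTheory`. Research context: cell `pub-hodge-ring2` (HONEST
FRAMING: research route conditional on HC_CM; not a corollary; Q11.4-sentence-2 already refuted in dim ≥ 3),
Literature lane gen 86, programme R73. UNCONDITIONAL for the class of abelian varieties it names; theorems only, no
definition, no named fact (D-0026), no `sorry`. The CELLS of the generic assembly `RibetTypeOfCoreSmulPowersHodgeClasses`
at the cores `UnitaryTenTwentyOne.eq_top_of_smul`, `UnitaryNineTwentyTwo.eq_top_of_smul`,
`UnitaryEight.eq_top_of_smul_twentythree` (two `r = 6` stalls closed by the constant-rank no-go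
`HodgeThetaSubalgebraUnitaryConstantRankLevi`, and one Euclid step onto `(8 | 15)`), and the census they refine: the
per-`X` residual of the prime dimension `31` shrinks from `{8,23}, {9,22}, {10,21}, {12,19}, {15,16}` to `{12,19}, {15,16}`.

THE PRINTED THEOREM. Ribet, Amer. J. Math. 105 (1983), Thm. 3 = Gordon's survey Thm. 6.3 (3) [held
`paper:arxiv-alg-geom_9709030` p. 18].

* §1 the three cells (and mirrors `'`), the Hodge conjecture for these powers, 31-FOLDS of the three signatures.
* §2 `isDivisorGenerated_powSucc_of_isSimple_thirtyonefold''`: `B• = D•` on all powers of a simple `31`-fold granted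
  only `End⁰ = ℚ` and the `k`-signatures `{12, 19}`, `{15, 16}`.

## References
* [Ribet1983] K. A. Ribet, Amer. J. Math. 105 (1983), Thm. 0 and Thm. 3.
* [Gordon1997] B. B. Gordon, *A survey of the Hodge conjecture for abelian varieties*, Thm. 6.3 (3) and Corollary.
* [MoonenZarhin1999LowDim] B. Moonen, Yu. Zarhin, Math. Ann. 315 (1999), §2 (2.4), Thm. (2.7).
* [Deligne2000] P. Deligne, *The Hodge conjecture* (Clay, 2000), §1.
-/

noncomputable section

open CategoryTheory Module

namespace Literature.AlgebraicGeometry.HodgeTheory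

open Literature.AlgebraicGeometry.Motives
open Literature.AlgebraicGeometry.Motives.HodgeStructure

section Cells

/-- **Ribet 1983 Thm. 3 at `(n′, n″) = (10, 21)` — UNCONDITIONAL** (core `UnitaryTenTwentyOne.eq_top_of_smul`).
[cite: Ribet1983, Thm. 0 and Thm. 3] [cite: Gordon1997, Thm. 6.3 (3) and Corollary] -/
theorem AbelianVariety.isDivisorGenerated_powSucc_of_ribetTypeTenTwentyOne (A : AbelianVariety ℂ) (φ : A ⟶ A)
    {d : ℕ} (hd : 0 < d) (hφ : φ ≫ φ = -(d • 𝟙 A)) (hE2 : Module.finrank ℚ A.endAlgebra = 2)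
    (h10 : eigenMultiplicity A φ (Complex.I * (Real.sqrt d : ℂ)) = 10)
    (h21 : eigenMultiplicity A φ (-(Complex.I * (Real.sqrt d : ℂ))) = 21) (N : ℕ) :
    IsDivisorGenerated (A.powSucc N) := by
  refine AbelianVariety.isDivisorGenerated_powSucc_of_ribetType_ofCoreSmul A φ hd hφ hE2 (by omega) (by omega) ?_ N
  intro W' _ _ _ 𝔊 ι P' Q' s hbr hirr hι hιι hP' hQ' hfinP' hfinQ' hadd hsmul hsymm hPQ hdefP hdefQ hadj
  exact UnitaryTenTwentyOne.eq_top_of_smul hbr hirr hι hιι hP' hQ' (by rw [hfinP', h10]) (by rw [hfinQ', h21]) hadd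
    hsmul hsymm hPQ hdefP hdefQ hadj

/-- The mirror: `n_{i√d}(φ) = 21`, `n_{−i√d}(φ) = 10`. [cite: Ribet1983, Thm. 0 and Thm. 3] [cite: Gordon1997, Thm. 6.3 (3)] -/
theorem AbelianVariety.isDivisorGenerated_powSucc_of_ribetTypeTenTwentyOne' (A : AbelianVariety ℂ) (φ : A ⟶ A)
    {d : ℕ} (hd : 0 < d) (hφ : φ ≫ φ = -(d • 𝟙 A)) (hE2 : Module.finrank ℚ A.endAlgebra = 2)
    (h21 : eigenMultiplicity A φ (Complex.I * (Real.sqrt d : ℂ)) = 21)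
    (h10 : eigenMultiplicity A φ (-(Complex.I * (Real.sqrt d : ℂ))) = 10) (N : ℕ) :
    IsDivisorGenerated (A.powSucc N) := by
  refine AbelianVariety.isDivisorGenerated_powSucc_of_ribetType_ofCoreSmul A φ hd hφ hE2 (by omega) (by omega) ?_ N
  intro W' _ _ _ 𝔊 ι P' Q' s hbr hirr hι hιι hP' hQ' hfinP' hfinQ' hadd hsmul hsymm hPQ hdefP hdefQ hadj
  exact UnitaryTenTwentyOne.eq_top_of_smul' hbr hirr hι hιι hP' hQ' (by rw [hfinP', h21]) (by rw [hfinQ', h10]) hadd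
    hsmul hsymm hPQ hdefP hdefQ hadj

/-- **The Hodge conjecture for all powers `A^{N+1}` of an abelian variety of Ribet type `(10, 21)` — UNCONDITIONAL.**
[cite: Ribet1983, Thm. 3] [cite: Deligne2000, §1] -/
theorem hodgeConjectureFor_powSucc_of_ribetTypeTenTwentyOne (A : AbelianVariety ℂ) (φ : A ⟶ A)
    {d : ℕ} (hd : 0 < d) (hφ : φ ≫ φ = -(d • 𝟙 A)) (hE2 : Module.finrank ℚ A.endAlgebra = 2)
    (h10 : eigenMultiplicity A φ (Complex.I * (Real.sqrt d : ℂ)) = 10)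
    (h21 : eigenMultiplicity A φ (-(Complex.I * (Real.sqrt d : ℂ))) = 21) (N : ℕ) :
    HodgeConjectureFor (A.powSucc N).dim (A.powSucc N).X :=
  hodgeConjectureFor_of_isDivisorGenerated _
    (AbelianVariety.isDivisorGenerated_powSucc_of_ribetTypeTenTwentyOne A φ hd hφ hE2 h10 h21 N)

/-- **Ribet 1983 Thm. 3 at `(n′, n″) = (9, 22)` — UNCONDITIONAL** (core `UnitaryNineTwentyTwo.eq_top_of_smul`).
[cite: Ribet1983, Thm. 0 and Thm. 3] [cite: Gordon1997, Thm. 6.3 (3) and Corollary] -/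
theorem AbelianVariety.isDivisorGenerated_powSucc_of_ribetTypeNineTwentyTwo (A : AbelianVariety ℂ) (φ : A ⟶ A)
    {d : ℕ} (hd : 0 < d) (hφ : φ ≫ φ = -(d • 𝟙 A)) (hE2 : Module.finrank ℚ A.endAlgebra = 2)
    (h9 : eigenMultiplicity A φ (Complex.I * (Real.sqrt d : ℂ)) = 9)
    (h22 : eigenMultiplicity A φ (-(Complex.I * (Real.sqrt d : ℂ))) = 22) (N : ℕ) :
    IsDivisorGenerated (A.powSucc N) := by
  refine AbelianVariety.isDivisorGenerated_powSucc_of_ribetType_ofCoreSmul A φ hd hφ hE2 (by omega) (by omega) ?_ N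
  intro W' _ _ _ 𝔊 ι P' Q' s hbr hirr hι hιι hP' hQ' hfinP' hfinQ' hadd hsmul hsymm hPQ hdefP hdefQ hadj
  exact UnitaryNineTwentyTwo.eq_top_of_smul hbr hirr hι hιι hP' hQ' (by rw [hfinP', h9]) (by rw [hfinQ', h22]) hadd
    hsmul hsymm hPQ hdefP hdefQ hadj

/-- The mirror: `n_{i√d}(φ) = 22`, `n_{−i√d}(φ) = 9`. [cite: Ribet1983, Thm. 0 and Thm. 3] [cite: Gordon1997, Thm. 6.3 (3)] -/
theorem AbelianVariety.isDivisorGenerated_powSucc_of_ribetTypeNineTwentyTwo' (A : AbelianVariety ℂ) (φ : A ⟶ A)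
    {d : ℕ} (hd : 0 < d) (hφ : φ ≫ φ = -(d • 𝟙 A)) (hE2 : Module.finrank ℚ A.endAlgebra = 2)
    (h22 : eigenMultiplicity A φ (Complex.I * (Real.sqrt d : ℂ)) = 22)
    (h9 : eigenMultiplicity A φ (-(Complex.I * (Real.sqrt d : ℂ))) = 9) (N : ℕ) :
    IsDivisorGenerated (A.powSucc N) := by
  refine AbelianVariety.isDivisorGenerated_powSucc_of_ribetType_ofCoreSmul A φ hd hφ hE2 (by omega) (by omega) ?_ N
  intro W' _ _ _ 𝔊 ι P' Q' s hbr hirr hι hιι hP' hQ' hfinP' hfinQ' hadd hsmul hsymm hPQ hdefP hdefQ hadj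
  exact UnitaryNineTwentyTwo.eq_top_of_smul' hbr hirr hι hιι hP' hQ' (by rw [hfinP', h22]) (by rw [hfinQ', h9]) hadd
    hsmul hsymm hPQ hdefP hdefQ hadj

/-- **The Hodge conjecture for all powers `A^{N+1}` of an abelian variety of Ribet type `(9, 22)` — UNCONDITIONAL.**
[cite: Ribet1983, Thm. 3] [cite: Deligne2000, §1] -/
theorem hodgeConjectureFor_powSucc_of_ribetTypeNineTwentyTwo (A : AbelianVariety ℂ) (φ : A ⟶ A)
    {d : ℕ} (hd : 0 < d) (hφ : φ ≫ φ = -(d • 𝟙 A)) (hE2 : Module.finrank ℚ A.endAlgebra = 2)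
    (h9 : eigenMultiplicity A φ (Complex.I * (Real.sqrt d : ℂ)) = 9)
    (h22 : eigenMultiplicity A φ (-(Complex.I * (Real.sqrt d : ℂ))) = 22) (N : ℕ) :
    HodgeConjectureFor (A.powSucc N).dim (A.powSucc N).X :=
  hodgeConjectureFor_of_isDivisorGenerated _
    (AbelianVariety.isDivisorGenerated_powSucc_of_ribetTypeNineTwentyTwo A φ hd hφ hE2 h9 h22 N)

/-- **Ribet 1983 Thm. 3 at `(n′, n″) = (8, 23)` — UNCONDITIONAL** (core `UnitaryEight.eq_top_of_smul_twentythree`).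
[cite: Ribet1983, Thm. 0 and Thm. 3] [cite: Gordon1997, Thm. 6.3 (3) and Corollary] -/
theorem AbelianVariety.isDivisorGenerated_powSucc_of_ribetTypeEightTwentyThree (A : AbelianVariety ℂ) (φ : A ⟶ A)
    {d : ℕ} (hd : 0 < d) (hφ : φ ≫ φ = -(d • 𝟙 A)) (hE2 : Module.finrank ℚ A.endAlgebra = 2)
    (h8 : eigenMultiplicity A φ (Complex.I * (Real.sqrt d : ℂ)) = 8)
    (h23 : eigenMultiplicity A φ (-(Complex.I * (Real.sqrt d : ℂ))) = 23) (N : ℕ) :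
    IsDivisorGenerated (A.powSucc N) := by
  refine AbelianVariety.isDivisorGenerated_powSucc_of_ribetType_ofCoreSmul A φ hd hφ hE2 (by omega) (by omega) ?_ N
  intro W' _ _ _ 𝔊 ι P' Q' s hbr hirr hι hιι hP' hQ' hfinP' hfinQ' hadd hsmul hsymm hPQ hdefP hdefQ hadj
  exact UnitaryEight.eq_top_of_smul_twentythree hbr hirr hι hιι hP' hQ' (by rw [hfinP', h8]) (by rw [hfinQ', h23])
    hadd hsmul hsymm hPQ hdefP hdefQ hadj

/-- The mirror: `n_{i√d}(φ) = 23`, `n_{−i√d}(φ) = 8`. [cite: Ribet1983, Thm. 0 and Thm. 3] [cite: Gordon1997, Thm. 6.3 (3)] -/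
theorem AbelianVariety.isDivisorGenerated_powSucc_of_ribetTypeEightTwentyThree' (A : AbelianVariety ℂ) (φ : A ⟶ A)
    {d : ℕ} (hd : 0 < d) (hφ : φ ≫ φ = -(d • 𝟙 A)) (hE2 : Module.finrank ℚ A.endAlgebra = 2)
    (h23 : eigenMultiplicity A φ (Complex.I * (Real.sqrt d : ℂ)) = 23)
    (h8 : eigenMultiplicity A φ (-(Complex.I * (Real.sqrt d : ℂ))) = 8) (N : ℕ) :
    IsDivisorGenerated (A.powSucc N) := by
  refine AbelianVariety.isDivisorGenerated_powSucc_of_ribetType_ofCoreSmul A φ hd hφ hE2 (by omega) (by omega) ?_ N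
  intro W' _ _ _ 𝔊 ι P' Q' s hbr hirr hι hιι hP' hQ' hfinP' hfinQ' hadd hsmul hsymm hPQ hdefP hdefQ hadj
  exact UnitaryEight.eq_top_of_smul_twentythree' hbr hirr hι hιι hP' hQ' (by rw [hfinP', h23]) (by rw [hfinQ', h8])
    hadd hsmul hsymm hPQ hdefP hdefQ hadj

/-- **The Hodge conjecture for all powers `A^{N+1}` of an abelian variety of Ribet type `(8, 23)` — UNCONDITIONAL.**
[cite: Ribet1983, Thm. 3] [cite: Deligne2000, §1] -/
theorem hodgeConjectureFor_powSucc_of_ribetTypeEightTwentyThree (A : AbelianVariety ℂ) (φ : A ⟶ A)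
    {d : ℕ} (hd : 0 < d) (hφ : φ ≫ φ = -(d • 𝟙 A)) (hE2 : Module.finrank ℚ A.endAlgebra = 2)
    (h8 : eigenMultiplicity A φ (Complex.I * (Real.sqrt d : ℂ)) = 8)
    (h23 : eigenMultiplicity A φ (-(Complex.I * (Real.sqrt d : ℂ))) = 23) (N : ℕ) :
    HodgeConjectureFor (A.powSucc N).dim (A.powSucc N).X :=
  hodgeConjectureFor_of_isDivisorGenerated _
    (AbelianVariety.isDivisorGenerated_powSucc_of_ribetTypeEightTwentyThree A φ hd hφ hE2 h8 h23 N)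

/-- **31-FOLDS of signature `{10, 21}`, `{9, 22}` or `{8, 23}`: `B• = D•` on all powers — UNCONDITIONAL** (either
eigenvalue may carry the smaller multiplicity). [cite: Ribet1983, Thm. 0 and Thm. 3] [cite: MoonenZarhin1999LowDim, §2 (2.4)] -/
theorem AbelianVariety.isDivisorGenerated_powSucc_of_thirtyonefold_tenTwentyOne_nineTwentyTwo_eightTwentyThree
    (A : AbelianVariety ℂ) (φ : A ⟶ A) {d : ℕ} (hd : 0 < d) (hφ : φ ≫ φ = -(d • 𝟙 A))
    (hE2 : Module.finrank ℚ A.endAlgebra = 2) (hX : A.dim = 31)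
    (hsig : eigenMultiplicity A φ (Complex.I * (Real.sqrt d : ℂ)) = 8 ∨ eigenMultiplicity A φ (Complex.I * (Real.sqrt d : ℂ)) = 9 ∨
      eigenMultiplicity A φ (Complex.I * (Real.sqrt d : ℂ)) = 10 ∨ eigenMultiplicity A φ (Complex.I * (Real.sqrt d : ℂ)) = 21 ∨
      eigenMultiplicity A φ (Complex.I * (Real.sqrt d : ℂ)) = 22 ∨ eigenMultiplicity A φ (Complex.I * (Real.sqrt d : ℂ)) = 23)
    (N : ℕ) : IsDivisorGenerated (A.powSucc N) := by
  have hsum := eigenMultiplicity_add_eigenMultiplicity_neg_eq_dim A φ hd hφ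
  rw [hX] at hsum
  rcases hsig with h | h | h | h | h | h
  · exact AbelianVariety.isDivisorGenerated_powSucc_of_ribetTypeEightTwentyThree A φ hd hφ hE2 h (by omega) N
  · exact AbelianVariety.isDivisorGenerated_powSucc_of_ribetTypeNineTwentyTwo A φ hd hφ hE2 h (by omega) N
  · exact AbelianVariety.isDivisorGenerated_powSucc_of_ribetTypeTenTwentyOne A φ hd hφ hE2 h (by omega) N
  · exact AbelianVariety.isDivisorGenerated_powSucc_of_ribetTypeTenTwentyOne' A φ hd hφ hE2 h (by omega) N
  · exact AbelianVariety.isDivisorGenerated_powSucc_of_ribetTypeNineTwentyTwo' A φ hd hφ hE2 h (by omega) N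
  · exact AbelianVariety.isDivisorGenerated_powSucc_of_ribetTypeEightTwentyThree' A φ hd hφ hE2 h (by omega) N

/-- **The Hodge conjecture for all powers of a 31-FOLD of signature `{10, 21}`, `{9, 22}` or `{8, 23}` —
UNCONDITIONAL.** [cite: Ribet1983, Thm. 3] [cite: Deligne2000, §1] -/
theorem hodgeConjectureFor_powSucc_of_thirtyonefold_tenTwentyOne_nineTwentyTwo_eightTwentyThree
    (A : AbelianVariety ℂ) (φ : A ⟶ A) {d : ℕ} (hd : 0 < d) (hφ : φ ≫ φ = -(d • 𝟙 A))
    (hE2 : Module.finrank ℚ A.endAlgebra = 2) (hX : A.dim = 31)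
    (hsig : eigenMultiplicity A φ (Complex.I * (Real.sqrt d : ℂ)) = 8 ∨ eigenMultiplicity A φ (Complex.I * (Real.sqrt d : ℂ)) = 9 ∨
      eigenMultiplicity A φ (Complex.I * (Real.sqrt d : ℂ)) = 10 ∨ eigenMultiplicity A φ (Complex.I * (Real.sqrt d : ℂ)) = 21 ∨
      eigenMultiplicity A φ (Complex.I * (Real.sqrt d : ℂ)) = 22 ∨ eigenMultiplicity A φ (Complex.I * (Real.sqrt d : ℂ)) = 23)
    (N : ℕ) : HodgeConjectureFor (A.powSucc N).dim (A.powSucc N).X :=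
  hodgeConjectureFor_of_isDivisorGenerated _
    (AbelianVariety.isDivisorGenerated_powSucc_of_thirtyonefold_tenTwentyOne_nineTwentyTwo_eightTwentyThree A φ hd hφ
      hE2 hX hsig N)

end Cells

/-! ### §2 Per-`X` census in dimension `31` -/

section Census

variable {X : AbelianVariety ℂ}

/-- **`B• = D•` on all powers of a SIMPLE complex abelian `31`-FOLD, granted ONLY `End⁰ = ℚ` and the `k`-signatures
`{12, 19}`, `{15, 16}`** (the cells `{14, 17}`, `{8, 23}`, `{9, 22}`, `{10, 21}` are theorems).
[cite: MoonenZarhin1999LowDim, §2 (2.4) and Thm. (2.7)] [cite: Ribet1983, Thms. 0–3] -/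
theorem isDivisorGenerated_powSucc_of_isSimple_thirtyonefold'' (hs : X.IsSimple) (hX : X.dim = 31)
    (h1 : Module.finrank ℚ X.endAlgebra = 1 → ∀ N : ℕ, IsDivisorGenerated (X.powSucc N))
    (hres : ∀ (φ : X ⟶ X) (d : ℕ), 0 < d → φ ≫ φ = -(d • 𝟙 X) → Module.finrank ℚ X.endAlgebra = 2 →
      (eigenMultiplicity X φ (Complex.I * (Real.sqrt d : ℂ)) = 12 ∨ eigenMultiplicity X φ (Complex.I * (Real.sqrt d : ℂ)) = 15 ∨
        eigenMultiplicity X φ (Complex.I * (Real.sqrt d : ℂ)) = 16 ∨ eigenMultiplicity X φ (Complex.I * (Real.sqrt d : ℂ)) = 19) →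
      ∀ N : ℕ, IsDivisorGenerated (X.powSucc N))
    (N : ℕ) : IsDivisorGenerated (X.powSucc N) := by
  refine isDivisorGenerated_powSucc_of_isSimple_thirtyonefold' hs hX h1 (fun φ d hd hφ he2 h N => ?_) N
  by_cases hcell : eigenMultiplicity X φ (Complex.I * (Real.sqrt d : ℂ)) = 8 ∨
      eigenMultiplicity X φ (Complex.I * (Real.sqrt d : ℂ)) = 9 ∨ eigenMultiplicity X φ (Complex.I * (Real.sqrt d : ℂ)) = 10 ∨
      eigenMultiplicity X φ (Complex.I * (Real.sqrt d : ℂ)) = 21 ∨ eigenMultiplicity X φ (Complex.I * (Real.sqrt d : ℂ)) = 22 ∨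
      eigenMultiplicity X φ (Complex.I * (Real.sqrt d : ℂ)) = 23
  · exact AbelianVariety.isDivisorGenerated_powSucc_of_thirtyonefold_tenTwentyOne_nineTwentyTwo_eightTwentyThree X φ hd
      hφ he2 hX hcell N
  · exact hres φ d hd hφ he2 (by omega) N

/-- **The Hodge conjecture on all powers of a SIMPLE complex abelian `31`-FOLD, granted ONLY `End⁰ = ℚ` and the
`k`-signatures `{12, 19}`, `{15, 16}`.** [cite: Ribet1983, Thms. 0–3] [cite: Deligne2000, §1] -/
theorem hodgeConjectureFor_powSucc_of_isSimple_thirtyonefold'' (hs : X.IsSimple) (hX : X.dim = 31)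
    (h1 : Module.finrank ℚ X.endAlgebra = 1 → ∀ N : ℕ, IsDivisorGenerated (X.powSucc N))
    (hres : ∀ (φ : X ⟶ X) (d : ℕ), 0 < d → φ ≫ φ = -(d • 𝟙 X) → Module.finrank ℚ X.endAlgebra = 2 →
      (eigenMultiplicity X φ (Complex.I * (Real.sqrt d : ℂ)) = 12 ∨ eigenMultiplicity X φ (Complex.I * (Real.sqrt d : ℂ)) = 15 ∨
        eigenMultiplicity X φ (Complex.I * (Real.sqrt d : ℂ)) = 16 ∨ eigenMultiplicity X φ (Complex.I * (Real.sqrt d : ℂ)) = 19) →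
      ∀ N : ℕ, IsDivisorGenerated (X.powSucc N))
    (N : ℕ) : HodgeConjectureFor (X.powSucc N).dim (X.powSucc N).X :=
  hodgeConjectureFor_of_isDivisorGenerated _ (isDivisorGenerated_powSucc_of_isSimple_thirtyonefold'' hs hX h1 hres N)

end Census

end Literature.AlgebraicGeometry.HodgeTheory

end
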